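import Summits.BirchSwinnertonDyer.Rank1Residual.Additive.X3BranchLayerTClassFull
import Summits.BirchSwinnertonDyer.Rank1Residual.Additive.X3BranchKummerLayerTwistedZeta27
import HarnessLib

/-!
# X3, the DEGENERATE rows OFF the sub-locus: ONE T-SIDE CLASS OVER THE SECOND LAYER — from a twisted
# Kummer radical `β = b^{1/3}`, `b = B(ζ₂₇) ∈ ℤ[ζ₂₇]`, to a class `c ∈ H¹(ℚ_Σ/ℚ_∞, Φ₀)` with its
# character EXPORTED (cell `bsd-eis`, seat `bsd-eis-x3` gen 8; the second-layer version of
# `X3BranchLayerTClassFull.lean`: the twisted descent `KummerLayerTwisted.exists_twistedKummerChar` on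
# the layer group `G₂ = κ.layerSubgroup 2` (which fixes `θ₂ = ζ₂₇ + ζ₂₇⁻¹`), the class of an additive
# character (`LayerAddChar`), inertia away from `3n`; x3-MEMO-10 §5 (f); route K1 `AdditiveBranchIMC`,
# crux `GordTwoRankZeroOffCaseOne` — supports only)

HONEST FRAMING (`run/shared/lean/pub/bsd-eis/README.md` §4): THEOREMS ONLY (no `def`, no named fact,
no `sorry`); nothing is booked; no label, tier or count of record moves.

## What

`κ` cyclotomic, `ζ` a primitive `27`-th root of unity (`ζ₃ = ζ⁹`, `θ₂ = ζ + ζ²⁶`), `B, B', E ∈ ℤ[X]`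
with `B(ζ)B'(ζ) = n ≠ 0` supported on `Σ₀` and the FLIP relation `B(ζ²⁶)B(ζ) = E(θ₂)³`, `β³ = B(ζ)`.
* `inertia_smul_zeta27`, `inertia_smul_conj_radical27` — `I_v` (`v ∤ 3n`) fixes `ζ` and every `σβ`;
* `exists_layerTwoTClass_full` — a character `χ : Γ_ℚ → ℤ/3`, locally constant, additive on `G₂`,
  the twisted Kummer character of `β` on `G₂` (`σβ = ζ₃^{χσ}β` if `σζ₃ = ζ₃`,
  `σβ = ζ₃^m E(θ₂) β⁻¹`, `χσ = −m` otherwise), vanishing on `I_v` for `v ∤ 3n`, and a class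
  `c ∈ residualLineH1` whose cocycle on `G_{ℚ_∞}` is `h ↦ χ(h)·x₀`.
References: [GreenbergVatsal2000] §2 pp. 28–30; [SerreLocalFields1979] Ch. X §3; [Washington1997]
§13.1.
-/

set_option autoImplicit false

noncomputable section

open scoped Classical AddSubgroup

namespace Summit.BirchSwinnertonDyer.Rank1Residual.Additive

namespace KummerLayerTwisted

open Field Polynomial NumberField IsDedekindDomain WeierstrassCurve
  Literature.NumberTheory.GaloisRepresentations
  Literature.NumberTheory.EllipticCurves
  Literature.NumberTheory.EllipticCurves.GreenbergSelmer
  Literature.NumberTheory.EllipticCurves.GreenbergVatsal2000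
  Literature.NumberTheory.EllipticCurves.Rank1Residual
  Summit.BirchSwinnertonDyer.Rank1Residual.Iwasawa.CyclotomicLayerOne
  TrivialLineClasses

/-! ### §1 Inertia away from `3n` -/

/-- **`I_v` fixes `ζ₂₇` for `v ∤ 3`** (the mod-`27` cyclotomic character is unramified away from `3`).
[cite: Washington1997, §2] -/
theorem inertia_smul_zeta27 {ζ : AlgebraicClosure ℚ} (hζ : IsPrimitiveRoot ζ 27)
    {v : HeightOneSpectrum (𝓞 ℚ)} (h3v : ((3 : ℕ) : 𝓞 ℚ) ∉ v.asIdeal)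
    {τ : absoluteGaloisGroup ℚ} (hτ : τ ∈ inertia v) : τ • ζ = ζ := by
  haveI : NeZero ((27 : ℕ) : ℚ) := ⟨by norm_num⟩
  haveI : Fact (1 < 27) := ⟨by norm_num⟩
  set 𝔓 := adicCompletionPrime ℚ v with h𝔓def
  have h𝔓 : 𝔓 ∈ v.primesAbove := adicCompletionPrime_mem_primesAbove ℚ v
  have hτ' : τ ∈ 𝔓.inertia (absoluteGaloisGroup ℚ) := by
    rw [h𝔓def, inertia_adicCompletionPrime_eq_map_absInertia]; exact hτ
  set q : ℕ := (Rat.HeightOneSpectrum.primesEquiv (R := 𝓞 ℚ) v : ℕ) with hqdef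
  have hq : q.Prime := (Rat.HeightOneSpectrum.primesEquiv (R := 𝓞 ℚ) v).2
  have hqv : (q : 𝓞 ℚ) ∈ v.asIdeal := Rat.HeightOneSpectrum.natCast_natGenerator_mem v
  have hq27 : ¬ q ∣ 27 := by
    intro h
    have hd : q ∣ 3 := hq.dvd_of_dvd_pow (show q ∣ 3 ^ 3 by norm_num; exact h)
    have h3 : q = 3 := (Nat.prime_dvd_prime_iff_eq hq Nat.prime_three).mp hd
    exact h3v (by rw [← h3]; exact_mod_cast hqv)
  have hχ := Rat.modNCyclotomicCharacter_eq_one_of_mem_inertia (N := 27) hq hq27 hqv h𝔓 hτ'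
  have h := modNCyclotomicCharacter_spec ℚ 27 τ ζ hζ.pow_eq_one
  rw [hχ, Units.val_one, ZMod.val_one, pow_one] at h
  exact h

/-- **`I_v` fixes every conjugate radical `σβ`** (`v ∤ 3n`): `(σβ)³ = B(ζ^k)` with cofactor `B'(ζ^k)`,
product `n`, a `v`-unit. [cite: SerreLocalFields1979, Ch. X §3] -/
theorem inertia_smul_conj_radical27 {ζ : AlgebraicClosure ℚ} (hζ : IsPrimitiveRoot ζ 27)
    (B B' : ℤ[X]) {n : ℕ} (hn : aeval ζ B * aeval ζ B' = (n : AlgebraicClosure ℚ))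
    {β : AlgebraicClosure ℚ} (hβ : β ^ 3 = aeval ζ B)
    {v : HeightOneSpectrum (𝓞 ℚ)} (h3v : ((3 : ℕ) : 𝓞 ℚ) ∉ v.asIdeal)
    (hnv : ((n : ℕ) : 𝓞 ℚ) ∉ v.asIdeal) {τ : absoluteGaloisGroup ℚ} (hτ : τ ∈ inertia v)
    (σ : absoluteGaloisGroup ℚ) : τ • (σ • β) = σ • β := by
  haveI : Fact (Nat.Prime 3) := ⟨Nat.prime_three⟩
  have h27 : (σ • ζ) ^ 27 = 1 := by rw [← smul_pow', hζ.pow_eq_one, smul_one]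
  obtain ⟨k, -, hk⟩ := hζ.eq_pow_of_pow_eq_one h27
  have hσb : σ • aeval ζ B = aeval (ζ ^ k) B := by rw [smul_aeval_eq, ← hk]
  have hσb' : σ • aeval ζ B' = aeval (ζ ^ k) B' := by rw [smul_aeval_eq, ← hk]
  have hζint : IsIntegral (𝓞 ℚ) ζ := (hζ.isIntegral (by norm_num)).tower_top
  have hζkint : IsIntegral (𝓞 ℚ) (ζ ^ k) := hζint.pow k
  have hprod : aeval (ζ ^ k) B * aeval (ζ ^ k) B' = (n : AlgebraicClosure ℚ) := by
    rw [← hσb, ← hσb', ← smul_mul', hn, absoluteGaloisGroup.smul_def, map_natCast]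
  have hβσ : (σ • β) ^ 3 = aeval (ζ ^ k) B := by rw [← smul_pow', hβ, hσb]
  have hτζ : τ • ζ = ζ := inertia_smul_zeta27 hζ h3v hτ
  have hτb : τ • aeval (ζ ^ k) B = aeval (ζ ^ k) B := by rw [smul_aeval_eq, smul_pow', hτζ]
  exact KummerLayerClasses.smul_eq_self_of_mem_inertia_of_pow_eq_of_dvd (p := 3)
    (isPrimitiveRoot_zeta27_pow_nine hζ) (isIntegral_aeval_int hζkint B)
    (isIntegral_aeval_int hζkint B') hprod hβσ h3v hnv hτ hτb

/-! ### §2 The class over the second layer -/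

variable {W : WeierstrassCurve ℚ}

/-- **One T-side class over the second layer, full export.** See the module docstring.
[cite: GreenbergVatsal2000, §2 pp. 28–30] [cite: SerreLocalFields1979, Ch. X §3]
[cite: Washington1997, §13.1] -/
theorem exists_layerTwoTClass_full [hp : Fact (Nat.Prime 3)]
    (κ : ZpExtension ℚ 3) (hκ : κ.IsCyclotomic) (S₀ : Finset (HeightOneSpectrum (𝓞 ℚ)))
    {Φ₀ : AddSubgroup (W.geomTorsion ((3 : ℕ) : ℤ))} (hΦ : IsRationalLine W 3 Φ₀)
    (htriv : ∀ (σ : absoluteGaloisGroup ℚ) (Pt : geomTorsion W ((3 : ℕ) : ℤ)), Pt ∈ Φ₀ → σ • Pt = Pt)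
    (x₀ : (residualLine Φ₀ hΦ).Sub) (hx₀ : 3 • x₀ = 0)
    {ζ : AlgebraicClosure ℚ} (hζ : IsPrimitiveRoot ζ 27)
    (B B' E : ℤ[X]) {n : ℕ} (hn0 : n ≠ 0)
    (hn : aeval ζ B * aeval ζ B' = (n : AlgebraicClosure ℚ))
    (hnS : ∀ v : HeightOneSpectrum (𝓞 ℚ), ((n : ℕ) : 𝓞 ℚ) ∈ v.asIdeal → v ∈ S₀)
    (hflip : aeval (ζ ^ 26) B * aeval ζ B = aeval (ζ + ζ ^ 26) E ^ 3)
    {β : AlgebraicClosure ℚ} (hβ : β ^ 3 = aeval ζ B) :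
    ∃ (χ : absoluteGaloisGroup ℚ → ZMod 3)
      (c : subgroupH1 κ.kerSubgroup (residualLine Φ₀ hΦ).Sub),
      c ∈ residualLineH1 W 3 κ S₀ Φ₀ hΦ ∧
      (∀ h : κ.kerSubgroup, (cocycleOf κ.kerSubgroup (residualLine Φ₀ hΦ).Sub
        (subgroup_smul_eq_self_of_trivial κ.kerSubgroup (residualLine_smul_eq_self hΦ htriv)) c).1 h =
        (χ h).val • x₀) ∧
      IsLocallyConstant χ ∧
      (∀ σ ∈ κ.layerSubgroup 2, ∀ τ ∈ κ.layerSubgroup 2, χ (σ * τ) = χ σ + χ τ) ∧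
      (∀ σ ∈ κ.layerSubgroup 2, σ • ζ ^ 9 = ζ ^ 9 →
        ∃ m : ℕ, σ • β = (ζ ^ 9) ^ m * β ∧ χ σ = m) ∧
      (∀ σ ∈ κ.layerSubgroup 2, σ • ζ ^ 9 ≠ ζ ^ 9 →
        ∃ m : ℕ, σ • β = (ζ ^ 9) ^ m * aeval (ζ + ζ ^ 26) E * β⁻¹ ∧ χ σ = -(m : ZMod 3)) ∧
      (∀ v : HeightOneSpectrum (𝓞 ℚ), ((3 : ℕ) : 𝓞 ℚ) ∉ v.asIdeal →
        ((n : ℕ) : 𝓞 ℚ) ∉ v.asIdeal → ∀ τ ∈ inertia v, χ τ = 0) := by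
  have htrivΦ := residualLine_smul_eq_self hΦ htriv
  have hHG : κ.kerSubgroup ≤ κ.layerSubgroup 2 := κ.kerSubgroup_le_layerSubgroup 2
  have hζ₃ : IsPrimitiveRoot (ζ ^ 9) 3 := isPrimitiveRoot_zeta27_pow_nine hζ
  -- `θ₂ = ζ + ζ²⁶` is fixed by the layer group `G₂`
  have hG2θ : ∀ σ ∈ κ.layerSubgroup 2, σ • (ζ + ζ ^ 26) = ζ + ζ ^ 26 := fun σ hσ ↦
    smul_theta27_eq_self_of_mem_layerSubgroup_two hκ hζ hσ
  have hb0 : aeval ζ B ≠ 0 := by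
    intro h0
    rw [h0, zero_mul, eq_comm, Nat.cast_eq_zero] at hn
    exact hn0 hn
  have heG : ∀ σ ∈ κ.layerSubgroup 2, σ • aeval (ζ + ζ ^ 26) E = aeval (ζ + ζ ^ 26) E :=
    fun σ hσ ↦ by rw [smul_aeval_eq, hG2θ σ hσ]
  have hfix : ∀ σ ∈ κ.layerSubgroup 2, σ • ζ ^ 9 = ζ ^ 9 → σ • aeval ζ B = aeval ζ B :=
    fun σ hσ h9 ↦ smul_aeval_zeta27_eq_self hζ B (hG2θ σ hσ) h9
  have hflip' : ∀ σ ∈ κ.layerSubgroup 2, σ • ζ ^ 9 ≠ ζ ^ 9 →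
      σ • aeval ζ B * aeval ζ B = aeval (ζ + ζ ^ 26) E ^ 3 := fun σ hσ h9 ↦ by
    rw [smul_aeval_zeta27_eq_aeval_pow_26 hζ B (hG2θ σ hσ) h9, hflip]
  -- the twisted Kummer character on `G₂`
  obtain ⟨χ, hχlc, hχadd, hχ₁, hχ₂⟩ :=
    exists_twistedKummerChar (κ.layerSubgroup 2) hζ₃ hb0 hβ heG hfix hflip'
  set χ' : absoluteGaloisGroup ℚ → (residualLine Φ₀ hΦ).Sub := fun g ↦ (χ g).val • x₀ with hχ'def
  have hχ'add : ∀ a ∈ κ.layerSubgroup 2, ∀ b ∈ κ.layerSubgroup 2, χ' (a * b) = χ' a + χ' b := by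
    intro a ha b hb
    simp only [hχ'def, hχadd a ha b hb, ZMod.val_add, ← nsmul_eq_mod_nsmul _ hx₀, add_nsmul]
  have hχ'cont : Continuous χ' := (hχlc.comp fun z : ZMod 3 ↦ z.val • x₀).continuous
  obtain ⟨c, hc⟩ := LayerAddChar.exists_class_of_addCharOn κ.kerSubgroup htrivΦ hHG χ' hχ'add hχ'cont
  have hβ0 : β ≠ 0 := by
    rintro rfl
    exact hb0 (by rw [← hβ]; norm_num)
  -- vanishing on inertia away from `3n`
  have hinert : ∀ v : HeightOneSpectrum (𝓞 ℚ), ((3 : ℕ) : 𝓞 ℚ) ∉ v.asIdeal →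
      ((n : ℕ) : 𝓞 ℚ) ∉ v.asIdeal → ∀ (σ : absoluteGaloisGroup ℚ), ∀ τ ∈ inertia v,
      χ (σ⁻¹ * τ * σ) = 0 := by
    intro v h3v hnv σ τ hτ
    have hτker : τ ∈ κ.kerSubgroup :=
      X2.GreenbergVatsalUnramifiedAway.inertia_le_kerSubgroup_of_isCyclotomic κ v hκ h3v hτ
    exact twistedChar_conj_eq_zero hζ₃ hβ0 hχ₁
      (by rw [smul_pow', inertia_smul_zeta27 hζ h3v hτ]) σ
      (inertia_smul_conj_radical27 hζ B B' hn hβ h3v hnv hτ σ)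
      (by
        have h := (κ.layerSubgroup_normal 2).conj_mem τ (hHG hτker) σ⁻¹
        simpa using h)
  refine ⟨χ, c, ?_, hc, hχlc, hχadd, hχ₁, hχ₂, fun v h3v hnv τ hτ ↦ ?_⟩
  · change c ∈ unramifiedOutside κ.kerSubgroup (residualLine Φ₀ hΦ).Sub 3
      (↑S₀ : Set (HeightOneSpectrum (𝓞 ℚ)))
    refine LayerAddChar.mem_unramifiedOutside_of_addCharOn κ.kerSubgroup htrivΦ hHG χ' hχ'add
      hχ'cont c hc 3 _ fun v hvS h3v σ τ hτ ↦ ?_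
    have hnv : ((n : ℕ) : 𝓞 ℚ) ∉ v.asIdeal := fun h ↦ hvS (hnS v h)
    simp only [hχ'def, hinert v h3v hnv σ τ hτ, ZMod.val_zero, zero_nsmul]
  · have h := hinert v h3v hnv 1 τ hτ
    simpa using h

end KummerLayerTwisted

end Summit.BirchSwinnertonDyer.Rank1Residual.Additive

end
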